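import Summits.BirchSwinnertonDyer.BirchSwinnertonDyer.Theorems.ResidualThetaTransportAtTwoSignedMuSeedAtTwoPlusTiltRecursion
import Literature.NumberTheory.EllipticCurves.FormalGroupOmegaInvarianceProofs
import Literature.NumberTheory.EllipticCurves.FormalGroupInvariantDifferentialProofs
import Literature.AlgebraicGeometry.Resolution.MvPowerSeriesChainRule
import HarnessLib

/-!
# Seed crux `SignedMuSeedAtTwoPlus` (stmt-BirchSwinnertonDyer-21438), line `norm-field-tilt`:
# the hypotheses of stub S2 DISCHARGED for the chord–tangent formal group of a Weierstrass curve

Cell `bsd-wall`, width seat `bsd-wall-rtt-p4-w2` g10; fourth file on the line, on top of p656802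
(`…TiltRecursion`, the abstract CLAIM `tiltRecursion_step` with hypotheses: `u' = 0`, translation shape
`φ = t + u·y + y²·r`, invariance `u·φ' = u∘φ`).  HONEST FRAMING: THEOREMS ONLY; closes no item; the line is NOT
registered; BSD is NOT proved by this.

Here `u = η = W.formalEta` is the inverse invariant differential of the chord–tangent formal group law
`F = W.formalGroupLaw ∈ k⟦z₀, z₁⟧` of a Weierstrass curve `W/k` (tree: `FormalInvariantDerivation.lean`; the invariant
derivation `D = η·d/dz` is `W.formalInvariantDerivation`), and the translation by `y ∈ k⟦t⟧` is
`t ⊕ y := F(y, t) = MvPowerSeries.subst ![y, X] F`.  Proved, for EVERY Weierstrass curve: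

* `derivative_formalEta_of_charP_two` — in characteristic `2`, `η' = C a₁` (a constant: the Hasse invariant), so
  `D (D f) = a₁ · D f` (`formalInvariantDerivation_comp`) and **`a₁ = 0` (supersingular, e.g. the tilt curve
  `y² + y = x³`) ⟹ `η' = 0`** — item (a) of stub S2 discharged; for the tilt curve even `η = 1`
  (`formalEta_eq_one`), i.e. `D = d/dt̄` on `y² + a₃ y = x³ + a₄ x` in characteristic `2`;
* `formalGroupLaw_eq_X_add` — the `z₀`-ADIC EXPANSION `F = z₁ + z₀·η(z₁) + z₀²·H` over any ring (from the tree's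
  `F(0,T) = T` and `F_X(0,T) = η(T)`, `FormalGroupNegProofs` / `FormalGroupInvariantDifferentialProofs`), hence
  the translation shape `t ⊕ y = t + η·y + y²·r` (`exists_translate_eq`) — item (c)/(d)'s shape discharged;
* `derivative_translate` — if `y' = 0` (in the line `y_m = ([±v]t̄)^{4^{m+1}}` is a `4^{m+1}`-th power) then
  `(t ⊕ y)' = (∂₁F)(y, t)` (chain rule, `MvPowerSeriesChainRule`), and over a domain
  `η·(t ⊕ y)' = η(t ⊕ y)` (`formalEta_mul_derivative_translate`, from the tree's `η(z₁)·∂₁F = η(F)`,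
  `FormalGroupOmegaInvarianceProofs`) — the invariance hypothesis discharged;
* **`tiltRecursion_step_formalGroupLaw`** — the CLAIM of stub S2 for `F`: `k` a domain of characteristic `2`,
  `a₁ = 0`, `Z ≠ 0`, `Z·S = η·Z'` (`S = D log Z`), `y(0) = 0`, `ord S = v`, `ord y = N`, `v + 2 < N`
  ⟹ `ord (S + S(t ⊕ y)) = 2v + N` (and, with `y' = 0`, `S + S(t ⊕ y) = D log (Z·Z(t ⊕ y))` — primed version).

What the line still has to supply at level `m` is now exactly: `Z = Z'_{ρ,m}`, `y = y_m = [h_m − 1]t̄` with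
`[h_m]t̄ = t̄ ⊕ y_m` (stub S1: the CM action on `Ê`), and `NonDeg(m)`. [folklore]
-/

noncomputable section

set_option autoImplicit false
set_option linter.dupNamespace false

open PowerSeries
open Literature.AlgebraicGeometry.Resolution (MvPowerSeries.pderiv MvPowerSeries.coeff_pderiv
  MvPowerSeries.pderiv_X)

namespace Summit.BirchSwinnertonDyer.BirchSwinnertonDyer.Theorems.SignedMuAtTwo.Tilt

variable {k : Type*} [CommRing k] (W : WeierstrassCurve k)

/-! ## (a) for a Weierstrass curve in characteristic `2`: `η' = a₁`, so `a₁ = 0 ⟹ D∘D = 0` -/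

section CharTwo

variable [CharP k 2]

/-- `2 = 0` in `k⟦X⟧` when `k` has characteristic `2`. [folklore] -/
theorem two_eq_zero_powerSeries : (2 : PowerSeries k) = 0 := by
  rw [← map_ofNat (C (R := k)) 2, CharTwo.two_eq_zero, map_zero]

/-- **`η' = a₁` in characteristic `2`** (for every Weierstrass curve): from
`η = 1 − a₁z − a₂z² − 2a₃w − 2a₄zw − 3a₆w²`, every term of `η'` but `−a₁ = a₁` carries a factor `2`.
So `η'` is the constant Hasse invariant `a₁`. [folklore] -/
theorem derivative_formalEta_of_charP_two : d⁄dX k W.formalEta = C W.a₁ := by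
  have h2 := two_eq_zero_powerSeries (k := k)
  -- in characteristic `2`: `η = 1 − (a₁z + a₂z² + a₆w²)`
  have hη : W.formalEta = 1 - (C W.a₁ * X + C W.a₂ * X ^ 2 + C W.a₆ * W.formalW ^ 2) := by
    rw [W.formalEta_def]
    linear_combination (-(C W.a₃ * W.formalW + C W.a₄ * X * W.formalW + C W.a₆ * W.formalW ^ 2)) * h2
  rw [hη, map_sub, Derivation.map_one_eq_zero, zero_sub, map_add, map_add, Derivation.leibniz,
    Derivation.leibniz, Derivation.leibniz, derivative_C, derivative_C, derivative_C, derivative_X,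
    Derivation.leibniz_pow, Derivation.leibniz_pow, derivative_X]
  simp only [smul_eq_mul, mul_one, nsmul_eq_mul, Nat.cast_ofNat]
  have hneg : -C W.a₁ = C W.a₁ := neg_eq_self _
  linear_combination hneg - (C W.a₂ * X + C W.a₆ * (W.formalW * d⁄dX k W.formalW)) * h2

/-- `D (D f) = a₁ · D f` in characteristic `2` (`D = η·d/dz = W.formalInvariantDerivation`):
`η(ηf')' = ηη'f' + η²f'' = a₁·ηf'`. [folklore] -/
theorem formalInvariantDerivation_comp (f : PowerSeries k) :
    W.formalInvariantDerivation (W.formalInvariantDerivation f) = C W.a₁ * W.formalInvariantDerivation f := by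
  rw [W.formalInvariantDerivation_apply, W.formalInvariantDerivation_apply, Derivation.leibniz,
    derivative_derivative_eq_zero, smul_zero, zero_add, smul_eq_mul, derivative_formalEta_of_charP_two]
  ring

/-- **Item (a) of stub S2 for a supersingular Weierstrass curve in characteristic `2`**: `a₁ = 0 ⟹ η' = 0`
(hence `D∘D = 0`, `mul_derivative_mul_derivative_eq_zero` of p656802). [folklore] -/
theorem derivative_formalEta_eq_zero (ha₁ : W.a₁ = 0) : d⁄dX k W.formalEta = 0 := by
  rw [derivative_formalEta_of_charP_two, ha₁, map_zero]

/-- For the tilt curve itself (`a₁ = a₂ = a₄ = a₆ = 0`, e.g. `y² + y = x³`) in characteristic `2` the inverse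
invariant differential is `η = 1`: the invariant derivation is plain `d/dt̄`. [folklore] -/
theorem formalEta_eq_one (ha₁ : W.a₁ = 0) (ha₂ : W.a₂ = 0) (ha₄ : W.a₄ = 0) (ha₆ : W.a₆ = 0) :
    W.formalEta = 1 := by
  rw [W.formalEta_def, ha₁, ha₂, ha₄, ha₆, map_zero, two_eq_zero_powerSeries]
  ring

end CharTwo


/-! ## The `z₀`-adic expansion `F = z₁ + z₀·η(z₁) + z₀²·H` and the translation shape -/

/-- `coeff m (X s · φ) = coeff (m − eₛ) φ` if `m s ≥ 1`, else `0`. [folklore] -/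
theorem coeff_X_mul' {σ : Type*} (s : σ) (φ : MvPowerSeries σ k) (m : σ →₀ ℕ) :
    MvPowerSeries.coeff m (MvPowerSeries.X s * φ) =
      if Finsupp.single s 1 ≤ m then MvPowerSeries.coeff (m - Finsupp.single s 1) φ else 0 := by
  rw [MvPowerSeries.X_def, MvPowerSeries.coeff_monomial_mul, one_mul]

/-- The coefficients of `F` on the axis `z₀ = 0`: `coeff_{(0,n)} F = [n = 1]` (`F(0, T) = T`). [folklore] -/
theorem coeff_single_one_formalGroupLaw (n : ℕ) :
    MvPowerSeries.coeff (Finsupp.single 1 n) W.formalGroupLaw = if n = 1 then 1 else 0 := by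
  rw [← Literature.NumberTheory.EllipticCurves.coeff_subst_zero_X, W.formalGroupLaw_subst_zero_X,
    PowerSeries.coeff_X]

/-- The coefficients of `F` of `z₀`-degree one: `coeff_{(1,n)} F = coeff_n η` (`F_X(0, T) = η(T)`). [folklore] -/
theorem coeff_single_one_add_single_zero_formalGroupLaw (n : ℕ) :
    MvPowerSeries.coeff (Finsupp.single 1 n + Finsupp.single 0 1) W.formalGroupLaw =
      PowerSeries.coeff n W.formalEta := by
  rw [← W.subst_zero_X_pderiv_formalGroupLaw, Literature.NumberTheory.EllipticCurves.coeff_subst_zero_X,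
    MvPowerSeries.coeff_pderiv]
  simp

/-- **The `z₀`-adic expansion of the chord–tangent law to second order** (every Weierstrass curve, every
commutative ring): `z₀² ∣ F − z₁ − z₀·η(z₁)`, i.e. `F(z₀, z₁) = z₁ + η(z₁)·z₀ + O(z₀²)`.
[Silverman AEC IV.2 (e), IV.4.2] [folklore] -/
theorem X_zero_sq_dvd_formalGroupLaw_sub :
    (MvPowerSeries.X 0 : MvPowerSeries (Fin 2) k) ^ 2 ∣
      W.formalGroupLaw - MvPowerSeries.X 1 -
        MvPowerSeries.X 0 * W.formalEta.subst (MvPowerSeries.X 1 : MvPowerSeries (Fin 2) k) := by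
  classical
  rw [MvPowerSeries.X_pow_dvd_iff]
  intro m hm
  have hle : ¬ Finsupp.single (0 : Fin 2) 1 ≤ Finsupp.single 1 (m 1) := fun h => by
    have := h 0; simp at this
  rcases Nat.lt_or_ge (m 0) 1 with h0 | h0
  · -- `m 0 = 0`: `m = (0, n)`
    have hm' : m = Finsupp.single 1 (m 1) := by
      ext i; fin_cases i
      · simpa using (Nat.lt_one_iff.mp h0)
      · simp
    rw [hm', map_sub, map_sub, coeff_single_one_formalGroupLaw, MvPowerSeries.coeff_X, coeff_X_mul',
      if_neg hle, sub_zero]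
    by_cases hn : m 1 = 1
    · rw [if_pos hn, if_pos (by rw [hn]), sub_self]
    · rw [if_neg hn, if_neg (fun h => hn (by simpa using (Finsupp.single_injective (1 : Fin 2)) h)),
        sub_zero]
  · -- `m 0 = 1`: `m = (1, n)`
    have h01 : m 0 = 1 := by omega
    have hm' : m = Finsupp.single 1 (m 1) + Finsupp.single 0 1 := by
      ext i; fin_cases i
      · simpa using h01
      · simp
    rw [hm', map_sub, map_sub, coeff_single_one_add_single_zero_formalGroupLaw, MvPowerSeries.coeff_X,
      coeff_X_mul', if_pos le_add_self, add_tsub_cancel_right, PowerSeries.coeff_subst_single,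
      if_neg (fun h => by simpa using (Finsupp.ext_iff.mp h) 0)]
    simp

/-- `![y, X]` (with `y(0) = 0`) is substitutable. [folklore] -/
theorem hasSubst_pair_X {y : PowerSeries k} (hy : constantCoeff y = 0) :
    MvPowerSeries.HasSubst ![y, (X : PowerSeries k)] :=
  MvPowerSeries.hasSubst_of_constantCoeff_zero fun i => by
    fin_cases i
    · exact hy
    · exact PowerSeries.constantCoeff_X

/-- **The translation shape** (items (c)/(d) of stub S2, discharged): for `y ∈ k⟦t⟧` with `y(0) = 0`,
`t ⊕ y := F(y, t) = t + η(t)·y + y²·r` for some `r ∈ k⟦t⟧`. [folklore] -/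
theorem exists_translate_eq {y : PowerSeries k} (hy : constantCoeff y = 0) :
    ∃ r : PowerSeries k,
      MvPowerSeries.subst ![y, (X : PowerSeries k)] W.formalGroupLaw = X + W.formalEta * y + y ^ 2 * r := by
  obtain ⟨H, hH⟩ := X_zero_sq_dvd_formalGroupLaw_sub W
  have hs := hasSubst_pair_X hy
  refine ⟨MvPowerSeries.subst ![y, (X : PowerSeries k)] H, ?_⟩
  have hF : W.formalGroupLaw = MvPowerSeries.X 1 +
      MvPowerSeries.X 0 * W.formalEta.subst (MvPowerSeries.X 1 : MvPowerSeries (Fin 2) k) +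
      MvPowerSeries.X 0 ^ 2 * H := by rw [← hH]; ring
  have hη : MvPowerSeries.subst ![y, (X : PowerSeries k)]
      (W.formalEta.subst (MvPowerSeries.X 1 : MvPowerSeries (Fin 2) k)) = W.formalEta := by
    rw [Literature.NumberTheory.EllipticCurves.mvSubst_powerSeries_subst (PowerSeries.HasSubst.X 1) hs,
      MvPowerSeries.subst_X hs]
    exact W.formalEta.X_subst
  conv_lhs => rw [hF]
  rw [← MvPowerSeries.coe_substAlgHom hs]
  simp only [map_add, map_mul, map_pow, MvPowerSeries.substAlgHom_X]
  rw [MvPowerSeries.coe_substAlgHom hs, hη]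
  simp only [Matrix.cons_val_zero, Matrix.cons_val_one]
  ring

/-! ## The derivative of the translation and the invariance hypothesis -/

/-- **`(t ⊕ y)' = (∂₁F)(y, t)` when `y' = 0`** (chain rule; in the line `y = y_m` is a `4^{m+1}`-th power in
characteristic `2`). [folklore] -/
theorem derivative_translate {y : PowerSeries k} (hy : constantCoeff y = 0) (hy' : d⁄dX k y = 0) :
    d⁄dX k (MvPowerSeries.subst ![y, (X : PowerSeries k)] W.formalGroupLaw) =
      MvPowerSeries.subst ![y, (X : PowerSeries k)] (MvPowerSeries.pderiv 1 W.formalGroupLaw) := by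
  have h := Literature.AlgebraicGeometry.Resolution.MvPowerSeries.pderiv_subst_pair
    (A := (y : MvPowerSeries Unit k)) (B := (X : PowerSeries k)) hy PowerSeries.constantCoeff_X
    (default : Unit) W.formalGroupLaw
  rw [Literature.AlgebraicGeometry.Resolution.MvPowerSeries.pderiv_unit_eq_derivative,
    Literature.AlgebraicGeometry.Resolution.MvPowerSeries.pderiv_unit_eq_derivative,
    Literature.AlgebraicGeometry.Resolution.MvPowerSeries.pderiv_unit_eq_derivative] at h
  change d⁄dX k _ = _ * d⁄dX k y + _ * d⁄dX k X at h
  rw [h, hy', mul_zero, zero_add, derivative_X, mul_one]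

/-- **The invariance hypothesis of stub S2, discharged** (over a domain): `η·(t ⊕ y)' = η(t ⊕ y)` when `y' = 0`
— from the tree's `η(z₁)·∂₁F = η(F)` (`formalEta_subst_X_mul_pderiv_formalGroupLaw`, Silverman AEC III.5.1 / IV.4)
substituted at `(z₀, z₁) = (y, t)`. [folklore] -/
theorem formalEta_mul_derivative_translate [IsDomain k] {y : PowerSeries k} (hy : constantCoeff y = 0)
    (hy' : d⁄dX k y = 0) :
    W.formalEta * d⁄dX k (MvPowerSeries.subst ![y, (X : PowerSeries k)] W.formalGroupLaw) =
      W.formalEta.subst (MvPowerSeries.subst ![y, (X : PowerSeries k)] W.formalGroupLaw) := by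
  have hs := hasSubst_pair_X hy
  have h := congrArg (MvPowerSeries.subst ![y, (X : PowerSeries k)])
    (W.formalEta_subst_X_mul_pderiv_formalGroupLaw 1)
  rw [← MvPowerSeries.coe_substAlgHom hs, map_mul, MvPowerSeries.coe_substAlgHom hs,
    Literature.NumberTheory.EllipticCurves.mvSubst_powerSeries_subst (PowerSeries.HasSubst.X 1) hs,
    MvPowerSeries.subst_X hs,
    Literature.NumberTheory.EllipticCurves.mvSubst_powerSeries_subst W.hasSubst_formalGroupLaw hs] at h
  rw [derivative_translate W hy hy']
  simpa [PowerSeries.X_subst] using h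

/-! ## The CLAIM of stub S2 for the chord–tangent formal group -/

section CharTwo

variable [CharP k 2]

/-- **Stub S2 `TiltRecursion` for the formal group of a Weierstrass curve.**  `k` a domain of characteristic `2`,
`W/k` with `a₁ = 0` (supersingular; the tilt curve `y² + y = x³` has moreover `η = 1`), `D = η·d/dt`; a level datum
`Z ≠ 0` with `Z·S = η·Z'` (`S = D log Z`) and a translation `y` with `y(0) = 0`; then
`ord S = v`, `ord y = N`, `v + 2 < N` ⟹ **`ord (S + S(t ⊕ y)) = 2v + N`**, where `t ⊕ y = F(y, t)`.  The
valuation count needs only `η' = 0` and the shape `t ⊕ y = t + η y + y² r` (NOT `y' = 0`); the invariance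
`η·(t ⊕ y)' = η(t ⊕ y)` (which does need `y' = 0`) is what identifies `S + S(t ⊕ y)` with `D log (Z·Z(t ⊕ y))`,
see the primed version. [folklore] -/
theorem tiltRecursion_step_formalGroupLaw [IsDomain k] (ha₁ : W.a₁ = 0) {Z S y : PowerSeries k} {v N : ℕ}
    (hZ : Z ≠ 0) (hZS : Z * S = W.formalEta * d⁄dX k Z) (hy0 : constantCoeff y = 0)
    (hS : S.order = v) (hy : y.order = N) (hvN : v + 2 < N) :
    PowerSeries.order (S + (S.subst (MvPowerSeries.subst ![y, (X : PowerSeries k)] W.formalGroupLaw) :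
      PowerSeries k)) = (2 * v + N : ℕ) := by
  obtain ⟨r, hr⟩ := exists_translate_eq W hy0
  exact tiltRecursion_step (derivative_formalEta_eq_zero W ha₁) hZ hZS hr hS hy hvN

/-- The same with the `D log` of the next level displayed: `Z⁺ = Z·Z(t ⊕ y)` satisfies `Z⁺·(S + S(t ⊕ y)) = η·(Z⁺)'`
(so `S + S(t ⊕ y)` IS `D log Z⁺`), and `ord (S + S(t ⊕ y)) = 2v + N`. [folklore] -/
theorem tiltRecursion_step_formalGroupLaw' [IsDomain k] (ha₁ : W.a₁ = 0) {Z S y : PowerSeries k} {v N : ℕ}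
    (hZ : Z ≠ 0) (hZS : Z * S = W.formalEta * d⁄dX k Z) (hy0 : constantCoeff y = 0) (hy' : d⁄dX k y = 0)
    (hS : S.order = v) (hy : y.order = N) (hvN : v + 2 < N) :
    (Z * Z.subst (MvPowerSeries.subst ![y, (X : PowerSeries k)] W.formalGroupLaw)) *
        (S + S.subst (MvPowerSeries.subst ![y, (X : PowerSeries k)] W.formalGroupLaw)) =
      W.formalEta * d⁄dX k (Z * Z.subst (MvPowerSeries.subst ![y, (X : PowerSeries k)] W.formalGroupLaw)) ∧
    PowerSeries.order (S + (S.subst (MvPowerSeries.subst ![y, (X : PowerSeries k)] W.formalGroupLaw) :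
      PowerSeries k)) = (2 * v + N : ℕ) := by
  refine ⟨logDeriv_levelStep ?_ (formalEta_mul_derivative_translate W hy0 hy') hZS,
    tiltRecursion_step_formalGroupLaw W ha₁ hZ hZS hy0 hS hy hvN⟩
  -- `(t ⊕ y)(0) = 0`
  obtain ⟨r, hr⟩ := exists_translate_eq W hy0
  rw [hr]
  simp [hy0]

end CharTwo

end Summit.BirchSwinnertonDyer.BirchSwinnertonDyer.Theorems.SignedMuAtTwo.Tilt

end
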